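import Summits.HubbardSuperconductivity.HubbardSuperconductivity.Theorems.AnisotropyChordTransferFibre3

/-!
# Route `AnisotropyChord` / H0 rotor rung: PORT N30-A proofs, part 1 — phases, the explicit fibre Hamiltonian, symmetries, Hermiticity

For the three-magnon `K`-fibre model of `…TransferFibre3` (theory seat `hubbard-h0-rotor-theory-1`, cycle 20, PORT SPEC N30-A):
* `phase` calculus: `phase K r = exp(2πi·val(K·r)/L)` depends on the `ZMod L` dot product only; `phase_add`, `phase_zero`,
  `phase_neg`, `phase_mul_conj`;
* `H0apply_four`: the free hopping as an explicit four-neighbour sum; linearity of `Happly`;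
* the bosonic symmetries `swap23`, `U12 K` commute with `Happly K Δ` (`Happly_swap23`, `Happly_U12`), hence
  `IsSymm K F → IsSymm K (Happly K Δ F)`; the hard core `InD` is invariant;
* Hermiticity `ip F (Happly K Δ G) = conj (ip G (Happly K Δ F))`.
Prover seat `hubbard-h0-rotor-p1` g21; helper for stmt-HubbardSuperconductivity-19089 (`--supports`).
-/

set_option linter.dupNamespace false
set_option autoImplicit false

noncomputable section

open scoped BigOperators
open Complex

namespace Summit.HubbardSuperconductivity.HubbardSuperconductivity.Theorems.AnisotropyChord.Transfer.Fibre3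

variable (L : ℕ) [NeZero L]

/-! ## Phases -/

/-- the character `x ↦ exp(2πi·val(x)/L)` of `ZMod L`. [folklore] -/
def phZ (x : ZMod L) : ℂ := Complex.exp (2 * Real.pi * Complex.I * (((x.val : ℕ) : ℂ) / (L : ℂ)))

/-- the `ZMod L`-valued dot product `K·r`. [folklore] -/
def dotZ (K r : Tor L) : ZMod L := K.1 * r.1 + K.2 * r.2

/-- `exp(2πi n/L)` only depends on `n mod L`. [folklore] -/
theorem exp_natCast_mod (n : ℕ) :
    Complex.exp (2 * Real.pi * Complex.I * (((n : ℕ) : ℂ) / (L : ℂ)))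
      = Complex.exp (2 * Real.pi * Complex.I * ((((n % L : ℕ)) : ℂ) / (L : ℂ))) := by
  have hL : (L : ℂ) ≠ 0 := by exact_mod_cast (NeZero.ne L)
  conv_lhs => rw [← Nat.mod_add_div n L]
  push_cast
  rw [add_div, mul_add, Complex.exp_add]
  have key : (L : ℂ) * ((n / L : ℕ) : ℂ) / (L : ℂ) = ((n / L : ℕ) : ℂ) := by
    rw [mul_comm]; exact mul_div_cancel_right₀ _ hL
  rw [key, show (2 * (Real.pi : ℂ) * Complex.I * ((n / L : ℕ) : ℂ) : ℂ) = ((n / L : ℕ) : ℂ) * (2 * Real.pi * Complex.I) by ring,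
    Complex.exp_nat_mul_two_pi_mul_I, mul_one]

/-- `phase K r = phZ (K·r)`. [folklore] -/
theorem phase_eq_phZ (K r : Tor L) : phase L K r = phZ L (dotZ L K r) := by
  unfold phase phZ dotZ
  rw [exp_natCast_mod L (K.1.val * r.1.val + K.2.val * r.2.val)]
  congr 4
  rw [ZMod.val_add, ZMod.val_mul, ZMod.val_mul, Nat.add_mod]

/-- `phZ (x + y) = phZ x · phZ y`. [folklore] -/
theorem phZ_add (x y : ZMod L) : phZ L (x + y) = phZ L x * phZ L y := by
  unfold phZ
  rw [ZMod.val_add, ← exp_natCast_mod L (x.val + y.val), ← Complex.exp_add]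
  congr 1; push_cast; ring

omit [NeZero L] in
/-- `phZ 0 = 1`. [folklore] -/
theorem phZ_zero : phZ L 0 = 1 := by
  unfold phZ; rw [ZMod.val_zero]; simp

/-- `phZ x · phZ (−x) = 1`. [folklore] -/
theorem phZ_mul_neg (x : ZMod L) : phZ L x * phZ L (-x) = 1 := by
  rw [← phZ_add, add_neg_cancel, phZ_zero]

/-- `conj (phZ x) = phZ (−x)`. [folklore] -/
theorem conj_phZ (x : ZMod L) : (starRingEnd ℂ) (phZ L x) = phZ L (-x) := by
  have h1 : (starRingEnd ℂ) (phZ L x) * phZ L x = 1 := by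
    unfold phZ
    rw [← Complex.exp_conj, ← Complex.exp_add]
    have : (starRingEnd ℂ) (2 * Real.pi * Complex.I * (((x.val : ℕ) : ℂ) / (L : ℂ)))
        + 2 * Real.pi * Complex.I * (((x.val : ℕ) : ℂ) / (L : ℂ)) = 0 := by
      simp only [map_mul, map_div₀, Complex.conj_ofReal, Complex.conj_I, map_natCast, map_ofNat]
      ring
    rw [this, Complex.exp_zero]
  have h2 := phZ_mul_neg L x
  have hne : phZ L x ≠ 0 := Complex.exp_ne_zero _
  calc (starRingEnd ℂ) (phZ L x) = (starRingEnd ℂ) (phZ L x) * (phZ L x * phZ L (-x)) := by rw [h2, mul_one]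
    _ = ((starRingEnd ℂ) (phZ L x) * phZ L x) * phZ L (-x) := by ring
    _ = phZ L (-x) := by rw [h1, one_mul]

/-- `phase K (r + r') = phase K r · phase K r'`. [folklore] -/
theorem phase_add (K r r' : Tor L) : phase L K (r + r') = phase L K r * phase L K r' := by
  rw [phase_eq_phZ, phase_eq_phZ, phase_eq_phZ, ← phZ_add]
  congr 1; unfold dotZ; simp only [Prod.fst_add, Prod.snd_add]; ring

/-- `phase K 0 = 1`. [folklore] -/
theorem phase_zero (K : Tor L) : phase L K 0 = 1 := by
  rw [phase_eq_phZ]; unfold dotZ; simp [phZ_zero]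

/-- `conj (phase K r) = phase K (−r)`. [folklore] -/
theorem conj_phase (K r : Tor L) : (starRingEnd ℂ) (phase L K r) = phase L K (-r) := by
  rw [phase_eq_phZ, phase_eq_phZ, conj_phZ]
  congr 1; unfold dotZ; simp only [Prod.fst_neg, Prod.snd_neg]; ring

/-- `phase K r · phase K (−r) = 1`. [folklore] -/
theorem phase_mul_neg (K r : Tor L) : phase L K r * phase L K (-r) = 1 := by
  rw [← phase_add, add_neg_cancel, phase_zero]

/-- `phase K (r − r') · phase K r' = phase K r`. [folklore] -/
theorem phase_sub_mul (K r r' : Tor L) : phase L K (r - r') * phase L K r' = phase L K r := by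
  rw [← phase_add, sub_add_cancel]


/-- `phase K e · (phase K (a − e) · z) = phase K a · z`. [folklore] -/
theorem phase_mul_phase_sub (K e a : Tor L) (z : ℂ) :
    phase L K e * (phase L K (a - e) * z) = phase L K a * z := by
  rw [← mul_assoc, mul_comm (phase L K e), phase_sub_mul]

/-! ## The fibre Hamiltonian as an explicit four-neighbour sum -/

/-- one hopping triple of `H0apply` in the direction `e`. [folklore] -/
def hopT (K : Tor L) (F : Cfg L → ℂ) (c : Cfg L) (e : Tor L) : ℂ :=
  F (c.1 + e, c.2) + F (c.1, c.2 + e) + phase L K e * F (c.1 - e, c.2 - e)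

/-- the first lattice direction `(1, 0)`. [folklore] -/
def ex : Tor L := ((1 : ZMod L), 0)

/-- the second lattice direction `(0, 1)`. [folklore] -/
def ey : Tor L := ((0 : ZMod L), 1)

omit [NeZero L] in
/-- the literal `(-1, 0)` is `−ex`. [folklore] -/
theorem neg_ex : (((-1 : ZMod L)), (0 : ZMod L)) = -ex L := by
  unfold ex; ext <;> simp

omit [NeZero L] in
/-- the literal `(0, -1)` is `−ey`. [folklore] -/
theorem neg_ey : (((0 : ZMod L)), (-1 : ZMod L)) = -ey L := by
  unfold ey; ext <;> simp

omit [NeZero L] in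
/-- `H0apply` written out: `6F(c) − ½ Σ_{e = ±eₓ, ±e_y} hopT e`. [folklore] -/
theorem H0apply_four (K : Tor L) (F : Cfg L → ℂ) (c : Cfg L) :
    H0apply L K F c = 6 * F c - (1 / 2 : ℂ) *
      (hopT L K F c (ex L) + hopT L K F c (-ex L) + hopT L K F c (ey L) + hopT L K F c (-ey L)) := by
  rw [← neg_ex, ← neg_ey]
  simp only [H0apply, nnList, hopT, ex, ey, List.map_cons, List.map_nil, List.sum_cons, List.sum_nil, add_zero]
  ring

omit [NeZero L] in
/-- `Happly` written out. [folklore] -/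
theorem Happly_four (K : Tor L) (Δ : ℝ) (F : Cfg L → ℂ) (c : Cfg L) :
    Happly L K Δ F c = 6 * F c - (1 / 2 : ℂ) *
      (hopT L K F c (ex L) + hopT L K F c (-ex L) + hopT L K F c (ey L) + hopT L K F c (-ey L))
      - (Δ : ℂ) * (Wcount L c : ℂ) * F c := by
  unfold Happly; rw [H0apply_four]

omit [NeZero L] in
/-- additivity of `Happly`. [folklore] -/
theorem Happly_add (K : Tor L) (Δ : ℝ) (F G : Cfg L → ℂ) :
    Happly L K Δ (F + G) = Happly L K Δ F + Happly L K Δ G := by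
  funext c
  simp only [Pi.add_apply, Happly_four, hopT]
  ring

omit [NeZero L] in
/-- homogeneity of `Happly`. [folklore] -/
theorem Happly_smul (K : Tor L) (Δ : ℝ) (a : ℂ) (F : Cfg L → ℂ) :
    Happly L K Δ (a • F) = a • Happly L K Δ F := by
  funext c
  simp only [Pi.smul_apply, smul_eq_mul, Happly_four, hopT]
  ring

/-! ## The bosonic symmetries commute with the Hamiltonian -/

/-- transposition `2 ↔ 3`: `(a, b) ↦ (b, a)`. [folklore] -/
def swap23 (F : Cfg L → ℂ) : Cfg L → ℂ := fun c => F (c.2, c.1)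

/-- transposition `1 ↔ 2` with the `K`-phase: `F ↦ (c ↦ e^{iK·a} F(−a, b−a))`. [folklore] -/
def U12 (K : Tor L) (F : Cfg L → ℂ) : Cfg L → ℂ := fun c => phase L K c.1 * F (-c.1, c.2 - c.1)

omit [NeZero L] in
/-- the nearest-neighbour indicator is even. [folklore] -/
theorem IsNN_neg (r : Tor L) : IsNN L (-r) = IsNN L r := by
  unfold IsNN
  have h1 : (-r = (((1 : ZMod L)), (0 : ZMod L))) ↔ (r = ((-1 : ZMod L), 0)) := by
    rw [neg_eq_iff_eq_neg]; constructor <;> intro h <;> rw [h] <;> ext <;> simp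
  have h2 : (-r = (((-1 : ZMod L)), (0 : ZMod L))) ↔ (r = ((1 : ZMod L), 0)) := by
    rw [neg_eq_iff_eq_neg]; constructor <;> intro h <;> rw [h] <;> ext <;> simp
  have h3 : (-r = (((0 : ZMod L)), (1 : ZMod L))) ↔ (r = ((0 : ZMod L), -1)) := by
    rw [neg_eq_iff_eq_neg]; constructor <;> intro h <;> rw [h] <;> ext <;> simp
  have h4 : (-r = (((0 : ZMod L)), (-1 : ZMod L))) ↔ (r = ((0 : ZMod L), 1)) := by
    rw [neg_eq_iff_eq_neg]; constructor <;> intro h <;> rw [h] <;> ext <;> simp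
  rw [Bool.decide_congr h1, Bool.decide_congr h2, Bool.decide_congr h3, Bool.decide_congr h4]
  cases decide (r = ((1 : ZMod L), 0)) <;> cases decide (r = ((-1 : ZMod L), 0)) <;>
    cases decide (r = ((0 : ZMod L), 1)) <;> cases decide (r = ((0 : ZMod L), -1)) <;> rfl

omit [NeZero L] in
/-- `W` is invariant under `2 ↔ 3`. [folklore] -/
theorem Wcount_swap (c : Cfg L) : Wcount L (c.2, c.1) = Wcount L c := by
  unfold Wcount
  have : c.1 - c.2 = -(c.2 - c.1) := by abel
  simp only [this, IsNN_neg]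
  ring

omit [NeZero L] in
/-- `W` is invariant under `1 ↔ 2`. [folklore] -/
theorem Wcount_U12 (c : Cfg L) : Wcount L (-c.1, c.2 - c.1) = Wcount L c := by
  unfold Wcount
  have : c.2 - c.1 - -c.1 = c.2 := by abel
  simp only [this, IsNN_neg]
  ring

omit [NeZero L] in
/-- the hard core is invariant under `2 ↔ 3`. [folklore] -/
theorem InD_swap (c : Cfg L) : InD L (c.2, c.1) = InD L c := by
  unfold InD
  have h : (c.2 = c.1) ↔ (c.1 = c.2) := eq_comm
  simp only [Bool.decide_congr h]
  cases decide (c.1 = 0) <;> cases decide (c.2 = 0) <;> cases decide (c.1 = c.2) <;> rfl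

omit [NeZero L] in
/-- the hard core is invariant under `1 ↔ 2`. [folklore] -/
theorem InD_U12 (c : Cfg L) : InD L (-c.1, c.2 - c.1) = InD L c := by
  unfold InD
  have h1 : (-c.1 = 0) ↔ (c.1 = 0) := neg_eq_zero
  have h2 : (c.2 - c.1 = 0) ↔ (c.1 = c.2) := by rw [sub_eq_zero]; exact eq_comm
  have h3 : (-c.1 = c.2 - c.1) ↔ (c.2 = 0) := by
    constructor
    · intro h
      have h' := congrArg (fun z => z + c.1) h
      simp only [neg_add_cancel, sub_add_cancel] at h'
      exact h'.symm
    · intro h; rw [h]; abel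
  simp only [Bool.decide_congr h1, Bool.decide_congr h2, Bool.decide_congr h3]
  cases decide (c.1 = 0) <;> cases decide (c.2 = 0) <;> cases decide (c.1 = c.2) <;> rfl

omit [NeZero L] in
/-- `H₀` commutes with `2 ↔ 3`. [folklore] -/
theorem H0apply_swap23 (K : Tor L) (F : Cfg L → ℂ) (c : Cfg L) :
    H0apply L K (swap23 L F) c = H0apply L K F (c.2, c.1) := by
  simp only [H0apply_four, hopT, swap23]
  ring

omit [NeZero L] in
/-- `H` commutes with `2 ↔ 3`. [folklore] -/
theorem Happly_swap23 (K : Tor L) (Δ : ℝ) (F : Cfg L → ℂ) (c : Cfg L) :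
    Happly L K Δ (swap23 L F) c = Happly L K Δ F (c.2, c.1) := by
  unfold Happly
  rw [H0apply_swap23, Wcount_swap]
  rfl

/-- `H₀` commutes with `1 ↔ 2` (this is what the `K`-phase on the diagonal hop is for). [folklore] -/
theorem H0apply_U12 (K : Tor L) (F : Cfg L → ℂ) (c : Cfg L) :
    H0apply L K (U12 L K F) c = U12 L K (H0apply L K F) c := by
  simp only [H0apply_four, hopT, U12]
  simp only [phase_add, phase_mul_phase_sub]
  ring_nf

/-- `H` commutes with `1 ↔ 2`. [folklore] -/
theorem Happly_U12 (K : Tor L) (Δ : ℝ) (F : Cfg L → ℂ) (c : Cfg L) :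
    Happly L K Δ (U12 L K F) c = U12 L K (Happly L K Δ F) c := by
  have h := H0apply_U12 L K F c
  unfold Happly
  rw [h]
  simp only [U12, Wcount_U12]
  ring

omit [NeZero L] in
/-- `IsSymm` as fixed points of the two transpositions. [folklore] -/
theorem isSymm_iff (K : Tor L) (F : Cfg L → ℂ) :
    IsSymm L K F ↔ swap23 L F = F ∧ U12 L K F = F := by
  unfold IsSymm swap23 U12
  constructor
  · rintro ⟨h1, h2⟩; exact ⟨funext h1, funext h2⟩
  · rintro ⟨h1, h2⟩; exact ⟨fun c => congrFun h1 c, fun c => congrFun h2 c⟩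

/-- **`H(Δ)` preserves the bosonic symmetry.** [folklore] -/
theorem isSymm_Happly (K : Tor L) (Δ : ℝ) {F : Cfg L → ℂ} (hF : IsSymm L K F) :
    IsSymm L K (Happly L K Δ F) := by
  rw [isSymm_iff] at hF ⊢
  obtain ⟨h1, h2⟩ := hF
  constructor
  · funext c
    show Happly L K Δ F (c.2, c.1) = Happly L K Δ F c
    rw [← Happly_swap23, h1]
  · funext c
    rw [← Happly_U12, h2]


/-! ## Hermiticity of the fibre Hamiltonian -/

/-- one directional hopping form `Σ_c conj(F c)·[G(c + (e,0)) + G(c + (0,e)) + e^{iK·e} G(c − (e,e))]`. [folklore] -/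
def hopSum (K : Tor L) (F G : Cfg L → ℂ) (e : Tor L) : ℂ :=
  ∑ c : Cfg L, (starRingEnd ℂ) (F c) * (G (c.1 + e, c.2) + G (c.1, c.2 + e) + phase L K e * G (c.1 - e, c.2 - e))

/-- `⟨F, H₀ G⟩` as diagonal plus four directional hopping forms. [folklore] -/
theorem ip_H0apply (K : Tor L) (F G : Cfg L → ℂ) :
    ip L F (H0apply L K G) = 6 * ip L F G - (1 / 2 : ℂ) *
      (hopSum L K F G (ex L) + hopSum L K F G (-ex L) + hopSum L K F G (ey L) + hopSum L K F G (-ey L)) := by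
  unfold ip hopSum
  simp only [H0apply_four, hopT]
  rw [Finset.mul_sum, ← Finset.sum_add_distrib, ← Finset.sum_add_distrib, ← Finset.sum_add_distrib, Finset.mul_sum,
    ← Finset.sum_sub_distrib]
  refine Finset.sum_congr rfl fun c _ => ?_
  ring

/-- reindexing of the straight hops: `Σ_c G(c)·conj F(c + v) = Σ_c conj F(c)·G(c − v)`. [folklore] -/
theorem sum_shift_conj (F G : Cfg L → ℂ) (v : Cfg L) :
    ∑ c : Cfg L, G c * (starRingEnd ℂ) (F (c + v)) = ∑ c : Cfg L, (starRingEnd ℂ) (F c) * G (c - v) := by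
  refine Fintype.sum_equiv (Equiv.addRight v) _ _ fun c => ?_
  simp only [Equiv.coe_addRight, add_sub_cancel_right]
  ring

/-- reindexing: `conj (hopSum K G F e) = hopSum K F G (−e)` (the hop in direction `e` is the adjoint of the hop in
direction `−e`; the diagonal hop carries the conjugate phase `e^{−iK·e} = e^{iK·(−e)}`). [folklore] -/
theorem conj_hopSum (K : Tor L) (F G : Cfg L → ℂ) (e : Tor L) :
    (starRingEnd ℂ) (hopSum L K G F e) = hopSum L K F G (-e) := by
  unfold hopSum
  rw [map_sum]
  simp only [map_mul, map_add, Complex.conj_conj, conj_phase, mul_add, Finset.sum_add_distrib]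
  -- the three hop types, each reindexed
  have p1 : ∀ c : Cfg L, (c.1 + e, c.2) = c + (e, 0) := fun c => by ext <;> simp
  have p2 : ∀ c : Cfg L, (c.1, c.2 + e) = c + (0, e) := fun c => by ext <;> simp
  have p3 : ∀ c : Cfg L, (c.1 - e, c.2 - e) = c + (-e, -e) := fun c => by ext <;> simp [sub_eq_add_neg]
  have q1 : ∀ c : Cfg L, c - ((e, 0) : Cfg L) = (c.1 + -e, c.2) := fun c => by ext <;> simp [sub_eq_add_neg]
  have q2 : ∀ c : Cfg L, c - ((0, e) : Cfg L) = (c.1, c.2 + -e) := fun c => by ext <;> simp [sub_eq_add_neg]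
  have q3 : ∀ c : Cfg L, c - ((-e, -e) : Cfg L) = (c.1 - -e, c.2 - -e) := fun c => by ext <;> simp
  have h1 : ∑ c : Cfg L, G c * (starRingEnd ℂ) (F (c.1 + e, c.2))
      = ∑ c : Cfg L, (starRingEnd ℂ) (F c) * G (c.1 + -e, c.2) := by
    simp only [p1, sum_shift_conj, q1]
  have h2 : ∑ c : Cfg L, G c * (starRingEnd ℂ) (F (c.1, c.2 + e))
      = ∑ c : Cfg L, (starRingEnd ℂ) (F c) * G (c.1, c.2 + -e) := by
    simp only [p2, sum_shift_conj, q2]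
  have h3 : ∑ c : Cfg L, G c * (phase L K (-e) * (starRingEnd ℂ) (F (c.1 - e, c.2 - e)))
      = ∑ c : Cfg L, (starRingEnd ℂ) (F c) * (phase L K (-e) * G (c.1 - -e, c.2 - -e)) := by
    have : ∑ c : Cfg L, G c * (phase L K (-e) * (starRingEnd ℂ) (F (c.1 - e, c.2 - e)))
        = phase L K (-e) * ∑ c : Cfg L, G c * (starRingEnd ℂ) (F (c + (-e, -e))) := by
      rw [Finset.mul_sum]
      refine Finset.sum_congr rfl fun c _ => ?_
      rw [p3]; ring
    rw [this, sum_shift_conj, Finset.mul_sum]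
    refine Finset.sum_congr rfl fun c _ => ?_
    rw [q3]; ring
  rw [h1, h2, h3]

/-- `conj ⟨G, F⟩ = ⟨F, G⟩`. [folklore] -/
theorem conj_ip (F G : Cfg L → ℂ) : (starRingEnd ℂ) (ip L G F) = ip L F G := by
  unfold ip
  rw [map_sum]
  refine Finset.sum_congr rfl fun c _ => ?_
  rw [map_mul, Complex.conj_conj, mul_comm]

/-- **Hermiticity of `H₀` in the `K` fibre:** `⟨F, H₀ G⟩ = conj ⟨G, H₀ F⟩`. [folklore] -/
theorem ip_H0apply_symm (K : Tor L) (F G : Cfg L → ℂ) :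
    ip L F (H0apply L K G) = (starRingEnd ℂ) (ip L G (H0apply L K F)) := by
  rw [ip_H0apply, ip_H0apply, map_sub, map_mul, map_mul, conj_ip]
  simp only [map_add, conj_hopSum, neg_neg, map_ofNat, map_div₀, map_one]
  ring

/-- `⟨F, W·G⟩ = conj ⟨G, W·F⟩` for the real diagonal `W`. [folklore] -/
theorem ip_W_symm (Δ : ℝ) (F G : Cfg L → ℂ) :
    ∑ c : Cfg L, (starRingEnd ℂ) (F c) * ((Δ : ℂ) * (Wcount L c : ℂ) * G c)
      = (starRingEnd ℂ) (∑ c : Cfg L, (starRingEnd ℂ) (G c) * ((Δ : ℂ) * (Wcount L c : ℂ) * F c)) := by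
  rw [map_sum]
  refine Finset.sum_congr rfl fun c _ => ?_
  simp only [map_mul, Complex.conj_conj, Complex.conj_ofReal, map_natCast]
  ring

/-- **Hermiticity of `H(Δ)` in the `K` fibre:** `⟨F, H G⟩ = conj ⟨G, H F⟩`. [folklore] -/
theorem ip_Happly_symm (K : Tor L) (Δ : ℝ) (F G : Cfg L → ℂ) :
    ip L F (Happly L K Δ G) = (starRingEnd ℂ) (ip L G (Happly L K Δ F)) := by
  have h0 := ip_H0apply_symm L K F G
  have hW := ip_W_symm L Δ F G
  unfold ip at h0 hW ⊢
  have eL : ∑ c : Cfg L, (starRingEnd ℂ) (F c) * Happly L K Δ G c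
      = ∑ c : Cfg L, (starRingEnd ℂ) (F c) * H0apply L K G c
        - ∑ c : Cfg L, (starRingEnd ℂ) (F c) * ((Δ : ℂ) * (Wcount L c : ℂ) * G c) := by
    rw [← Finset.sum_sub_distrib]
    refine Finset.sum_congr rfl fun c _ => ?_
    unfold Happly; ring
  have eR : ∑ c : Cfg L, (starRingEnd ℂ) (G c) * Happly L K Δ F c
      = ∑ c : Cfg L, (starRingEnd ℂ) (G c) * H0apply L K F c
        - ∑ c : Cfg L, (starRingEnd ℂ) (G c) * ((Δ : ℂ) * (Wcount L c : ℂ) * F c) := by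
    rw [← Finset.sum_sub_distrib]
    refine Finset.sum_congr rfl fun c _ => ?_
    unfold Happly; ring
  rw [eL, eR, map_sub, h0, hW]

end Summit.HubbardSuperconductivity.HubbardSuperconductivity.Theorems.AnisotropyChord.Transfer.Fibre3

end
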